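import Literature.NumberTheory.Automorphic.ResGLnConeDictionary
import Literature.NumberTheory.Automorphic.ResGLnCoeffModuleAdmissibleForm
import Literature.NumberTheory.Automorphic.PosFormRealification
import Literature.NumberTheory.Automorphic.GKCohomologyCasimir
import HarnessLib

/-!
# Kuga data for the `(𝔤, K_∞)`-complex of `W ⊗ E_λ`: the positive form `Re (⟨ , ⟩_W ⊗ adm)` and the
# twisted action `s = π ⊗ 1 - 1 ⊗ dE_λ`, with the adjunction `B(⁅X, a⁆, b) = -B(a, s(X) b)` on `𝔭`

Topic `NumberTheory/Automorphic`; namespace `Literature.NumberTheory.Automorphic.ConeDictionary`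
(the vocabulary of `ResGLnConeDictionary`: `Carrier π λ = W ⊗_ℂ E_λ(ℂ)` with the Leibniz action of
`𝔤 = 𝔤𝔩ₙ(K_∞)`, the complex `gkComplexLS π S λ`).  Definitions with bodies and theorems; no named
fact, no `sorry`.

Input (G2) of Step 2 of Borel's injectivity of cuspidal cohomology in the cone model
(`ResGLnCuspidalCohomologyApex`): the data `B`, `s` of Kuga's lemma in every degree
(`Literature.Algebra.Lie.ChevalleyEilenbergKugaAdjoint.d_eq_zero_of_casimirOp_eq_zero`) for the value
module `M = W ⊗ E_λ` [cite: BorelWallach2000, II §2.2–2.5]: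

* `carrierForm π λ ip = ⟨ , ⟩_W ⊗ adm` (`Kuga.tensorForm` in the coordinates of the orthonormal
  tensor basis `AdmissibleForm.archBasis` of the admissible form `archForm` on `E_λ(ℂ)`), positive
  definite Hermitian as soon as `⟨ , ⟩_W` is (`isPosForm_carrierForm`); `kugaB = Re carrierForm` as an
  `ℝ`-bilinear form with the hypotheses `hBs`, `hB`, `hBd` (`kugaB_symm`, `kugaB_self_nonneg`,
  `eq_zero_of_kugaB_self`);
* `kugaS π λ = σ₁ - σ₂ = π(·) ⊗ 1 - 1 ⊗ dE_λ(·)` (`GKTensor.sigmaLeft/sigmaRight`), equivariant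
  (`kugaS_equivariant`, the hypothesis `hσ`);
* **`kugaB_lie`** — for `X ∈ 𝔤` HERMITIAN with `Tr_{K_∞/ℝ} tr X = 0` (the family `x` of
  `ResGLnCartanData`), and `⟨ , ⟩_W` skew for such `X` (Petersson:
  `CuspidalPeterssonForm.pet_lieDerivW_left`): `B(⁅X, a⁆, b) = -B(a, s(X) b)` — the hypothesis `hadj`
  (`π(X) ⊗ 1` is skew, `1 ⊗ dE_λ(X)` is self-adjoint by `archForm_archCoeffLie_left_of_hermitian`).

## References

* A. Borel, N. Wallach, *Continuous cohomology, discrete subgroups, and representations of reductive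
  groups*, 2nd ed. (2000), II §2.2–2.5 (held). [BorelWallach2000]
-/

noncomputable section

namespace Literature.NumberTheory.Automorphic

-- `Classical`: the place subtypes indexing `mixedSpace K` are `Fintype` classically (as in `AdelicGLnGlue`).
open scoped TensorProduct Classical _root_.Matrix
open _root_.NumberField _root_.NumberField.mixedEmbedding

namespace ConeDictionary

variable {n : ℕ} {K : Type} [Field K] [NumberField K] {hcpt : isCompact_glFiniteIntegralLevel n K}
  (π : AutomorphicRepData (AutomorphyDatum.gl n K hcpt)) (lam : (K →+* ℂ) → Fin n → ℤ)

/-! ### The positive form `⟨ , ⟩_W ⊗ adm` on `W ⊗ E_λ` and its real part -/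

/-- **`⟨ , ⟩_W ⊗ adm`** on `W ⊗ E_λ(ℂ)` (the type underlying `Carrier π λ`): the form
`∑_I ⟨u_I, u'_I⟩_W` in the coordinates of the orthonormal tensor basis `archBasis` of the admissible
form of `E_λ(ℂ)`. [cite: BorelWallach2000, II §2.2] -/
def carrierForm (ip : π.W → π.W → ℂ) :
    π.W ⊗[ℂ] ResGLnCohomology.CoeffModule ℂ n K lam → π.W ⊗[ℂ] ResGLnCohomology.CoeffModule ℂ n K lam → ℂ :=
  Kuga.tensorForm ip (AdmissibleForm.archBasis n K lam)

/-- It is positive definite Hermitian as soon as `⟨ , ⟩_W` is. [cite: BorelWallach2000, II §2.2] -/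
theorem isPosForm_carrierForm {ip : π.W → π.W → ℂ} (hip : Kuga.IsPosForm ip) :
    Kuga.IsPosForm (carrierForm π lam ip) :=
  Kuga.isPosForm_tensorForm _ hip

set_option maxHeartbeats 800000 in
set_option synthInstance.maxHeartbeats 200000 in
-- the datum's `arch` is `archGroupGL n K` only definitionally; instance searches are deep here
/-- `π(X) ⊗ 1` is skew for `⟨ , ⟩_W ⊗ adm` when `π(X)` is skew for `⟨ , ⟩_W`. [cite: BorelWallach2000, II 2.2 (4)] -/
theorem carrierForm_rTensor_left {ip : π.W → π.W → ℂ} (hip : Kuga.IsPosForm ip)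
    (X : (AutomorphyDatum.gl n K hcpt).arch.lie) (hskew : ∀ w w' : π.W, ip (π.lieDerivW X w) w' = -ip w (π.lieDerivW X w'))
    (a b : π.W ⊗[ℂ] ResGLnCohomology.CoeffModule ℂ n K lam) :
    carrierForm π lam ip ((π.lieRepW X).rTensor _ a) b = -carrierForm π lam ip a ((π.lieRepW X).rTensor _ b) := by
  have hA : ∀ w w' : π.W, ip (π.lieRepW X w) w' = ip w (((-1 : ℂ) • π.lieRepW X) w') := fun w w' => by
    rw [AutomorphicRepData.lieRepW_apply, hskew, LinearMap.smul_apply, AutomorphicRepData.lieRepW_apply, hip.smul_right,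
      neg_one_mul]
  have h := Kuga.tensorForm_map_left_rTensor (AdmissibleForm.archBasis n K lam) (ipW := ip) hA a b
  rw [TensorProduct.map_smul_left, LinearMap.smul_apply, (Kuga.isPosForm_tensorForm _ hip).smul_right, neg_one_mul] at h
  exact h

/-- `1 ⊗ dE_λ(X)` is self-adjoint for `⟨ , ⟩_W ⊗ adm` when `X` is Hermitian (admissibility of `E_λ`).
[cite: BorelWallach2000, II 2.2 (5)] -/
theorem carrierForm_lTensor_left {ip : π.W → π.W → ℂ} (hip : Kuga.IsPosForm ip)
    (X : (AutomorphyDatum.gl n K hcpt).arch.lie) (hX : (X : Matrix (Fin n) (Fin n) (mixedSpace K))ᴴ = X)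
    (a b : π.W ⊗[ℂ] ResGLnCohomology.CoeffModule ℂ n K lam) :
    carrierForm π lam ip ((σ𝔤S hcpt lam X).lTensor π.W a) b = carrierForm π lam ip a ((σ𝔤S hcpt lam X).lTensor π.W b) := by
  have hC : ∀ e e' : ResGLnCohomology.CoeffModule ℂ n K lam,
      AdmissibleForm.archForm n K lam (σ𝔤S hcpt lam X e) e' = AdmissibleForm.archForm n K lam e (σ𝔤S hcpt lam X e') :=
    AdmissibleForm.archForm_archCoeffLie_left_of_hermitian n K lam hX
  exact Kuga.tensorForm_map_left_lTensor_of_orthonormal (AdmissibleForm.archBasis n K lam) hip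
    (AdmissibleForm.isPosForm_archForm n K lam) (AdmissibleForm.basisForm_basis (AdmissibleForm.archBasis n K lam)) hC a b

set_option maxHeartbeats 800000 in
set_option synthInstance.maxHeartbeats 200000 in
-- as above
/-- **The adjunction on `W ⊗ E_λ`**: for `X` Hermitian with `π(X)` skew,
`⟨X·a, b⟩ = -⟨a, (π(X) ⊗ 1 - 1 ⊗ dE_λ(X)) b⟩`, `X·a = (π(X) ⊗ 1 + 1 ⊗ dE_λ(X)) a` the Leibniz action.
[cite: BorelWallach2000, II 2.2 (4)–(5), 2.5] -/
theorem carrierForm_lie_left {ip : π.W → π.W → ℂ} (hip : Kuga.IsPosForm ip)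
    (X : (AutomorphyDatum.gl n K hcpt).arch.lie) (hX : (X : Matrix (Fin n) (Fin n) (mixedSpace K))ᴴ = X)
    (hskew : ∀ w w' : π.W, ip (π.lieDerivW X w) w' = -ip w (π.lieDerivW X w'))
    (a b : π.W ⊗[ℂ] ResGLnCohomology.CoeffModule ℂ n K lam) :
    carrierForm π lam ip (GKTensor.lie (AutomorphyDatum.gl n K hcpt).arch π.lieRepW (σ𝔤S hcpt lam) X a) b =
      -carrierForm π lam ip a
        ((π.lieRepW X).rTensor (ResGLnCohomology.CoeffModule ℂ n K lam) b - (σ𝔤S hcpt lam X).lTensor π.W b) := by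
  rw [GKTensor.lie_apply, LinearMap.add_apply, (isPosForm_carrierForm π lam hip).add_left,
    (isPosForm_carrierForm π lam hip).sub_right, carrierForm_rTensor_left π lam hip X hskew,
    carrierForm_lTensor_left π lam hip X hX]
  ring

/-- **`B = Re (⟨ , ⟩_W ⊗ adm)`** as an `ℝ`-bilinear form on the real vector space `Carrier π λ`
underlying `W ⊗ E_λ` (the `B` of Kuga's lemma over `R = ℝ`). [cite: BorelWallach2000, II §2.2] -/
def kugaB {ip : π.W → π.W → ℂ} (hip : Kuga.IsPosForm ip) : Carrier π lam →ₗ[ℝ] Carrier π lam →ₗ[ℝ] ℝ :=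
  (isPosForm_carrierForm π lam hip).reForm

/-- Unfolding. [folklore] -/
theorem kugaB_apply {ip : π.W → π.W → ℂ} (hip : Kuga.IsPosForm ip) (a b : Carrier π lam) :
    kugaB π lam hip a b = (carrierForm π lam ip a b).re :=
  rfl

/-- Hypothesis `hBs`: `B` is symmetric. [folklore] -/
theorem kugaB_symm {ip : π.W → π.W → ℂ} (hip : Kuga.IsPosForm ip) (a b : Carrier π lam) :
    kugaB π lam hip a b = kugaB π lam hip b a :=
  (isPosForm_carrierForm π lam hip).reForm_symm a b

/-- Hypothesis `hB`: `B(a, a) ≥ 0`. [folklore] -/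
theorem kugaB_self_nonneg {ip : π.W → π.W → ℂ} (hip : Kuga.IsPosForm ip) (a : Carrier π lam) :
    0 ≤ kugaB π lam hip a a :=
  (isPosForm_carrierForm π lam hip).reForm_self_nonneg a

/-- Hypothesis `hBd`: `B(a, a) = 0 ⇒ a = 0`. [folklore] -/
theorem eq_zero_of_kugaB_self {ip : π.W → π.W → ℂ} (hip : Kuga.IsPosForm ip) (a : Carrier π lam)
    (ha : kugaB π lam hip a a = 0) : a = 0 :=
  (isPosForm_carrierForm π lam hip).eq_zero_of_reForm_self_eq_zero a ha

/-! ### The twisted action `s = π ⊗ 1 - 1 ⊗ dE_λ` -/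

/-- **`s(X) = π(X) ⊗ 1 - 1 ⊗ dE_λ(X)`** (`σ₁ - σ₂`), the action through the Cartan involution on the
coefficient factor. [cite: BorelWallach2000, II §2.5] -/
def kugaS : (AutomorphyDatum.gl n K hcpt).arch.lie →ₗ[ℝ] Module.End ℝ (Carrier π lam) :=
  GKTensor.sigmaLeft (AutomorphyDatum.gl n K hcpt).arch π.lieRepW (σ𝔤S hcpt lam) -
    GKTensor.sigmaRight (AutomorphyDatum.gl n K hcpt).arch π.lieRepW (σ𝔤S hcpt lam)

set_option maxHeartbeats 800000 in
set_option synthInstance.maxHeartbeats 200000 in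
-- the datum's `arch` is `archGroupGL n K` only definitionally (as in `ResGLnConeDictionary`)
/-- **Hypothesis `hσ`: `s` is equivariant**, `θ(z) s(u) - s(u) θ(z) = s(⁅z, u⁆)`. [cite: BorelWallach2000, II §2.5] -/
theorem kugaS_equivariant (z u : (AutomorphyDatum.gl n K hcpt).arch.lie) :
    LieModule.toEnd ℝ (AutomorphyDatum.gl n K hcpt).arch.lie (Carrier π lam) z * kugaS π lam u -
        kugaS π lam u * LieModule.toEnd ℝ (AutomorphyDatum.gl n K hcpt).arch.lie (Carrier π lam) z =
      kugaS π lam ⁅z, u⁆ := by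
  have h1 := GKTensor.sigmaLeft_equivariant (AutomorphyDatum.gl n K hcpt).arch π.lieRepW (σ𝔤S hcpt lam) z u
  have h2 := GKTensor.sigmaRight_equivariant (AutomorphyDatum.gl n K hcpt).arch π.lieRepW (σ𝔤S hcpt lam) z u
  rw [kugaS, LinearMap.sub_apply, LinearMap.sub_apply, mul_sub, sub_mul, ← h1, ← h2]
  abel

set_option maxHeartbeats 800000 in
set_option synthInstance.maxHeartbeats 200000 in
-- as above
/-- **Hypothesis `hadj` of Kuga's lemma**: for `X ∈ 𝔤` Hermitian with `⟨ , ⟩_W` skew along `X`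
(Petersson: `Tr_{K_∞/ℝ} tr X = 0`, `CuspidalPeterssonForm.pet_lieDerivW_left`),
`B(⁅X, a⁆, b) = -B(a, s(X) b)`. [cite: BorelWallach2000, II 2.2 (4)–(5), 2.5] -/
theorem kugaB_lie {ip : π.W → π.W → ℂ} (hip : Kuga.IsPosForm ip)
    (X : (AutomorphyDatum.gl n K hcpt).arch.lie) (hX : (X : Matrix (Fin n) (Fin n) (mixedSpace K))ᴴ = X)
    (hskew : ∀ w w' : π.W, ip (π.lieDerivW X w) w' = -ip w (π.lieDerivW X w'))
    (a b : Carrier π lam) :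
    kugaB π lam hip ⁅X, a⁆ b = -kugaB π lam hip a (kugaS π lam X b) := by
  change (carrierForm π lam ip (GKTensor.lie (AutomorphyDatum.gl n K hcpt).arch π.lieRepW (σ𝔤S hcpt lam) X a) b).re =
    -(carrierForm π lam ip a
      ((π.lieRepW X).rTensor (ResGLnCohomology.CoeffModule ℂ n K lam) b - (σ𝔤S hcpt lam X).lTensor π.W b)).re
  rw [carrierForm_lie_left π lam hip X hX hskew, Complex.neg_re]

end ConeDictionary

end Literature.NumberTheory.Automorphic

end
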